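import Mathlib
import Summits.Ventures.PercRepro2.Defs
import Summits.Ventures.PercRepro2.Independence
import Summits.Ventures.PercRepro2.Harris
import Summits.Ventures.PercRepro2.Graph
import Summits.Ventures.PercRepro2.Exploration
import Summits.Ventures.PercRepro2.Events
import Summits.Ventures.PercRepro2.FourFunctions
import Summits.Ventures.PercRepro2.Induced
import Summits.Ventures.PercRepro2.Frontier
import Summits.Ventures.PercRepro2.ObsIndependence
import Summits.Ventures.PercRepro2.BHK
import Summits.Ventures.PercRepro2.BHKEvents
import Summits.Ventures.PercRepro2.VdBKahn
import Summits.Ventures.PercRepro2.BHKAvoid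
import Summits.Ventures.PercRepro2.GateDefs
import Summits.Ventures.PercRepro2.VTXDefs
import Summits.Ventures.PercRepro2.VTXSplitFrame
import Summits.Ventures.PercRepro2.HubModel
import Summits.Ventures.PercRepro2.HubLaw
import Summits.Ventures.PercRepro2.HubModel3
import Summits.Ventures.PercRepro2.HubLaw3
import Summits.Ventures.PercRepro2.HubPat3
import Summits.Ventures.PercRepro2.HubHarris3
import Summits.Ventures.PercRepro2.HubCert3Part1
import Summits.Ventures.PercRepro2.HubCert3Part2
import Summits.Ventures.PercRepro2.HubCert3Part3
import Summits.Ventures.PercRepro2.HubCert3Part4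
import Summits.Ventures.PercRepro2.HubCert3Part5
import Summits.Ventures.PercRepro2.HubCert3Part6

/-!
# The VDBK blocks of the a₃-hub certificates are nonnegative for the inner law (blind cell PercRepro2,
mine-2 g17; MINE2-A3FIRST.md §8.3)

The inner law of `G − a₃` is the law under the weights with every edge at `a₃` closed
(`NewVertex.prob_pinZ_eq`), so van den Berg–Kahn's Theorem 1.2 (`vdBK`) applies on the inner graph: a
`VDBK(s,A,B,X,Y)` block — `P(s~A∪B, s≁X∩Y)·P(s≁X∪Y) − P(s~A, s≁X)·P(s~B, s≁Y)` — is that instance written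
in the inner masses (the mark-image Finsets `X ∩ Y`, `X ∪ Y` computed on `Mark` by `decide` and transported
by the injectivity of `μ`; events → `innerPat3` predicates → sums over the atoms `atomPat3`, the predicates
evaluated on the 15 atoms by `decide`, the block polynomial by `ring`). Block definitions are textually
identical across the six part files, so a block proved in its first part is the block of every later part.
-/

namespace Summit.Ventures.PercRepro2.Hub3

open Hub

variable {V : Type*} {E : Type*} [Fintype E] [DecidableEq E] [Fintype V] [DecidableEq V]
  {R : Type*} [Field R] [LinearOrder R] [IsStrictOrderedRing R] {ends : E → Sym2 V} {μ : Mark → V}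

omit [LinearOrder R] [IsStrictOrderedRing R] in
/-- The inner law is the law under the weights with every edge at `a₃` closed. -/
lemma prob_inner_eq_pinZ_vdbk (p : E → R) (A : Set (Config E)) :
    prob (NewVertex.pinZ p ends (μ .a₃)) A = prob p {ω | innerConfig3 ends μ ω ∈ A} := by
  rw [NewVertex.prob_pinZ_eq]
  rfl

/-- `VDBK(s=2,A=,B=,X=1b,Y=o1)` — block 5 (first in part 1) — is nonnegative at the inner masses: `vdBK` on the inner graph (source `2`; `P(s~A, s≁X)·P(s~B, s≁Y) ≤ P(s~A∪B, s≁X∩Y)·P(s≁X∪Y)`), the mark-image Finsets resolved by the injectivity of `μ`. -/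
theorem part1_H5_nonneg (p : E → R) (hp : IsProbVec p) (hinj : Function.Injective μ) : 0 ≤ HubCert3.Part1.H5 (innerMass3 p ends μ) := by
  have h := vdBK (NewVertex.pinZ p ends (μ .a₃)) (NewVertex.isProbVec_pinZ p ends (μ .a₃) hp) ends (μ .a₂) (∅ : Finset V) (∅ : Finset V) ({μ .a₁, μ .b} : Finset V) ({μ .o, μ .a₁} : Finset V)
  have hXY : ({μ .a₁, μ .b} : Finset V) ∩ ({μ .o, μ .a₁} : Finset V) = ({μ .a₁} : Finset V) := by
    rw [show ({μ .a₁, μ .b} : Finset V) = Finset.image μ ({Mark.a₁, Mark.b} : Finset Mark) by simp, show ({μ .o, μ .a₁} : Finset V) = Finset.image μ ({Mark.o, Mark.a₁} : Finset Mark) by simp, ← Finset.image_inter _ _ hinj, show ({Mark.a₁, Mark.b} : Finset Mark) ∩ ({Mark.o, Mark.a₁} : Finset Mark) = {Mark.a₁} by decide]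
    simp
  have hXuY : ({μ .a₁, μ .b} : Finset V) ∪ ({μ .o, μ .a₁} : Finset V) = ({μ .o, μ .a₁, μ .b} : Finset V) := by
    rw [show ({μ .a₁, μ .b} : Finset V) = Finset.image μ ({Mark.a₁, Mark.b} : Finset Mark) by simp, show ({μ .o, μ .a₁} : Finset V) = Finset.image μ ({Mark.o, Mark.a₁} : Finset Mark) by simp, ← Finset.image_union, show ({Mark.a₁, Mark.b} : Finset Mark) ∪ ({Mark.o, Mark.a₁} : Finset Mark) = {Mark.o, Mark.a₁, Mark.b} by decide]
    simp
  rw [hXY, hXuY] at h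
  simp only [prob_inner_eq_pinZ_vdbk] at h
  have e_21 : ∀ ω : Config E, Conn ends (innerConfig3 ends μ ω) (μ .a₂) (μ .a₁) ↔ innerPat3 ends μ ω 3 = true := fun ω => ⟨fun h => (innerPat3_eq_true_iff ω 3).mpr (conn_symm h), fun h => conn_symm ((innerPat3_eq_true_iff ω 3).mp h)⟩
  have e_2b : ∀ ω : Config E, Conn ends (innerConfig3 ends μ ω) (μ .a₂) (μ .b) ↔ innerPat3 ends μ ω 5 = true := fun ω => (innerPat3_eq_true_iff ω 5).symm
  have e_2o : ∀ ω : Config E, Conn ends (innerConfig3 ends μ ω) (μ .a₂) (μ .o) ↔ innerPat3 ends μ ω 1 = true := fun ω => ⟨fun h => (innerPat3_eq_true_iff ω 1).mpr (conn_symm h), fun h => conn_symm ((innerPat3_eq_true_iff ω 1).mp h)⟩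
  have eA : {ω : Config E | innerConfig3 ends μ ω ∈ connAll ends (μ .a₂) (∅ : Finset V) ∩ avoidAll ends (μ .a₂) ({μ .a₁, μ .b} : Finset V)} = {ω | ((!(innerPat3 ends μ ω 3)) && (!(innerPat3 ends μ ω 5))) = true} := by ext ω; simp only [Set.mem_setOf_eq, Set.mem_inter_iff, connAll, avoidAll, Finset.notMem_empty, false_imp_iff, implies_true, true_and, Finset.mem_insert, Finset.mem_singleton, forall_eq_or_imp, forall_eq, Bool.and_eq_true, Bool.not_eq_true', Bool.not_eq_true, e_21, e_2b]
  have eB : {ω : Config E | innerConfig3 ends μ ω ∈ connAll ends (μ .a₂) (∅ : Finset V) ∩ avoidAll ends (μ .a₂) ({μ .o, μ .a₁} : Finset V)} = {ω | ((!(innerPat3 ends μ ω 1)) && (!(innerPat3 ends μ ω 3))) = true} := by ext ω; simp only [Set.mem_setOf_eq, Set.mem_inter_iff, connAll, avoidAll, Finset.notMem_empty, false_imp_iff, implies_true, true_and, Finset.mem_insert, Finset.mem_singleton, forall_eq_or_imp, forall_eq, Bool.and_eq_true, Bool.not_eq_true', Bool.not_eq_true, e_21, e_2o]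
  have eAB : {ω : Config E | innerConfig3 ends μ ω ∈ connAll ends (μ .a₂) ((∅ : Finset V) ∪ (∅ : Finset V)) ∩ avoidAll ends (μ .a₂) ({μ .a₁} : Finset V)} = {ω | (!(innerPat3 ends μ ω 3)) = true} := by ext ω; simp only [Set.mem_setOf_eq, Set.mem_inter_iff, connAll, avoidAll, Finset.empty_union, Finset.notMem_empty, false_imp_iff, implies_true, true_and, Finset.mem_singleton, forall_eq, Bool.not_eq_true', Bool.not_eq_true, e_21]
  have eXY : {ω : Config E | innerConfig3 ends μ ω ∈ avoidAll ends (μ .a₂) ({μ .o, μ .a₁, μ .b} : Finset V)} = {ω | ((!(innerPat3 ends μ ω 1)) && ((!(innerPat3 ends μ ω 3)) && (!(innerPat3 ends μ ω 5)))) = true} := by ext ω; simp only [Set.mem_setOf_eq, avoidAll, Finset.mem_insert, Finset.mem_singleton, forall_eq_or_imp, forall_eq, Bool.and_eq_true, Bool.not_eq_true', Bool.not_eq_true, e_21, e_2b, e_2o]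
  rw [eA, eB, eAB, eXY, prob_patEvent3 p (fun π => ((!(π 3)) && (!(π 5)))), prob_patEvent3 p (fun π => ((!(π 1)) && (!(π 3)))), prob_patEvent3 p (fun π => (!(π 3))), prob_patEvent3 p (fun π => ((!(π 1)) && ((!(π 3)) && (!(π 5)))))] at h
  have aA : ∀ a : Fin 15, ((!(atomPat3 a 3)) && (!(atomPat3 a 5))) = decide (a ∈ ({2, 4, 6, 7, 11, 12, 14} : Finset (Fin 15))) := by decide
  have aB : ∀ a : Fin 15, ((!(atomPat3 a 1)) && (!(atomPat3 a 3))) = decide (a ∈ ({2, 3, 4, 11, 12, 13, 14} : Finset (Fin 15))) := by decide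
  have aAB : ∀ a : Fin 15, (!(atomPat3 a 3)) = decide (a ∈ ({2, 3, 4, 5, 6, 7, 11, 12, 13, 14} : Finset (Fin 15))) := by decide
  have aXY : ∀ a : Fin 15, ((!(atomPat3 a 1)) && ((!(atomPat3 a 3)) && (!(atomPat3 a 5)))) = decide (a ∈ ({2, 4, 11, 12, 14} : Finset (Fin 15))) := by decide
  simp only [aXY] at h; simp only [aA, aB] at h; simp only [aAB, decide_eq_true_eq] at h
  have hb : HubCert3.Part1.H5 (innerMass3 p ends μ) = (∑ a, if a ∈ ({2, 3, 4, 5, 6, 7, 11, 12, 13, 14} : Finset (Fin 15)) then innerMass3 p ends μ a else 0) * (∑ a, if a ∈ ({2, 4, 11, 12, 14} : Finset (Fin 15)) then innerMass3 p ends μ a else 0) - (∑ a, if a ∈ ({2, 4, 6, 7, 11, 12, 14} : Finset (Fin 15)) then innerMass3 p ends μ a else 0) * (∑ a, if a ∈ ({2, 3, 4, 11, 12, 13, 14} : Finset (Fin 15)) then innerMass3 p ends μ a else 0) := by simp only [HubCert3.Part1.H5, Fin.sum_univ_succ, Fin.sum_univ_zero]; simp; ring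
  rw [hb]; linarith

/-- `VDBK(s=1,A=,B=,X=2b,Y=o2)` — block 14 (first in part 1) — is nonnegative at the inner masses: `vdBK` on the inner graph (source `1`; `P(s~A, s≁X)·P(s~B, s≁Y) ≤ P(s~A∪B, s≁X∩Y)·P(s≁X∪Y)`), the mark-image Finsets resolved by the injectivity of `μ`. -/
theorem part1_H14_nonneg (p : E → R) (hp : IsProbVec p) (hinj : Function.Injective μ) : 0 ≤ HubCert3.Part1.H14 (innerMass3 p ends μ) := by
  have h := vdBK (NewVertex.pinZ p ends (μ .a₃)) (NewVertex.isProbVec_pinZ p ends (μ .a₃) hp) ends (μ .a₁) (∅ : Finset V) (∅ : Finset V) ({μ .a₂, μ .b} : Finset V) ({μ .o, μ .a₂} : Finset V)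
  have hXY : ({μ .a₂, μ .b} : Finset V) ∩ ({μ .o, μ .a₂} : Finset V) = ({μ .a₂} : Finset V) := by
    rw [show ({μ .a₂, μ .b} : Finset V) = Finset.image μ ({Mark.a₂, Mark.b} : Finset Mark) by simp, show ({μ .o, μ .a₂} : Finset V) = Finset.image μ ({Mark.o, Mark.a₂} : Finset Mark) by simp, ← Finset.image_inter _ _ hinj, show ({Mark.a₂, Mark.b} : Finset Mark) ∩ ({Mark.o, Mark.a₂} : Finset Mark) = {Mark.a₂} by decide]
    simp
  have hXuY : ({μ .a₂, μ .b} : Finset V) ∪ ({μ .o, μ .a₂} : Finset V) = ({μ .o, μ .a₂, μ .b} : Finset V) := by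
    rw [show ({μ .a₂, μ .b} : Finset V) = Finset.image μ ({Mark.a₂, Mark.b} : Finset Mark) by simp, show ({μ .o, μ .a₂} : Finset V) = Finset.image μ ({Mark.o, Mark.a₂} : Finset Mark) by simp, ← Finset.image_union, show ({Mark.a₂, Mark.b} : Finset Mark) ∪ ({Mark.o, Mark.a₂} : Finset Mark) = {Mark.o, Mark.a₂, Mark.b} by decide]
    simp
  rw [hXY, hXuY] at h
  simp only [prob_inner_eq_pinZ_vdbk] at h
  have e_12 : ∀ ω : Config E, Conn ends (innerConfig3 ends μ ω) (μ .a₁) (μ .a₂) ↔ innerPat3 ends μ ω 3 = true := fun ω => (innerPat3_eq_true_iff ω 3).symm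
  have e_1b : ∀ ω : Config E, Conn ends (innerConfig3 ends μ ω) (μ .a₁) (μ .b) ↔ innerPat3 ends μ ω 4 = true := fun ω => (innerPat3_eq_true_iff ω 4).symm
  have e_1o : ∀ ω : Config E, Conn ends (innerConfig3 ends μ ω) (μ .a₁) (μ .o) ↔ innerPat3 ends μ ω 0 = true := fun ω => ⟨fun h => (innerPat3_eq_true_iff ω 0).mpr (conn_symm h), fun h => conn_symm ((innerPat3_eq_true_iff ω 0).mp h)⟩
  have eA : {ω : Config E | innerConfig3 ends μ ω ∈ connAll ends (μ .a₁) (∅ : Finset V) ∩ avoidAll ends (μ .a₁) ({μ .a₂, μ .b} : Finset V)} = {ω | ((!(innerPat3 ends μ ω 3)) && (!(innerPat3 ends μ ω 4))) = true} := by ext ω; simp only [Set.mem_setOf_eq, Set.mem_inter_iff, connAll, avoidAll, Finset.notMem_empty, false_imp_iff, implies_true, true_and, Finset.mem_insert, Finset.mem_singleton, forall_eq_or_imp, forall_eq, Bool.and_eq_true, Bool.not_eq_true', Bool.not_eq_true, e_12, e_1b]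
  have eB : {ω : Config E | innerConfig3 ends μ ω ∈ connAll ends (μ .a₁) (∅ : Finset V) ∩ avoidAll ends (μ .a₁) ({μ .o, μ .a₂} : Finset V)} = {ω | ((!(innerPat3 ends μ ω 0)) && (!(innerPat3 ends μ ω 3))) = true} := by ext ω; simp only [Set.mem_setOf_eq, Set.mem_inter_iff, connAll, avoidAll, Finset.notMem_empty, false_imp_iff, implies_true, true_and, Finset.mem_insert, Finset.mem_singleton, forall_eq_or_imp, forall_eq, Bool.and_eq_true, Bool.not_eq_true', Bool.not_eq_true, e_12, e_1o]
  have eAB : {ω : Config E | innerConfig3 ends μ ω ∈ connAll ends (μ .a₁) ((∅ : Finset V) ∪ (∅ : Finset V)) ∩ avoidAll ends (μ .a₁) ({μ .a₂} : Finset V)} = {ω | (!(innerPat3 ends μ ω 3)) = true} := by ext ω; simp only [Set.mem_setOf_eq, Set.mem_inter_iff, connAll, avoidAll, Finset.empty_union, Finset.notMem_empty, false_imp_iff, implies_true, true_and, Finset.mem_singleton, forall_eq, Bool.not_eq_true', Bool.not_eq_true, e_12]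
  have eXY : {ω : Config E | innerConfig3 ends μ ω ∈ avoidAll ends (μ .a₁) ({μ .o, μ .a₂, μ .b} : Finset V)} = {ω | ((!(innerPat3 ends μ ω 0)) && ((!(innerPat3 ends μ ω 3)) && (!(innerPat3 ends μ ω 4)))) = true} := by ext ω; simp only [Set.mem_setOf_eq, avoidAll, Finset.mem_insert, Finset.mem_singleton, forall_eq_or_imp, forall_eq, Bool.and_eq_true, Bool.not_eq_true', Bool.not_eq_true, e_12, e_1b, e_1o]
  rw [eA, eB, eAB, eXY, prob_patEvent3 p (fun π => ((!(π 3)) && (!(π 4)))), prob_patEvent3 p (fun π => ((!(π 0)) && (!(π 3)))), prob_patEvent3 p (fun π => (!(π 3))), prob_patEvent3 p (fun π => ((!(π 0)) && ((!(π 3)) && (!(π 4)))))] at h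
  have aA : ∀ a : Fin 15, ((!(atomPat3 a 3)) && (!(atomPat3 a 4))) = decide (a ∈ ({3, 4, 5, 7, 11, 13, 14} : Finset (Fin 15))) := by decide
  have aB : ∀ a : Fin 15, ((!(atomPat3 a 0)) && (!(atomPat3 a 3))) = decide (a ∈ ({5, 6, 7, 11, 12, 13, 14} : Finset (Fin 15))) := by decide
  have aAB : ∀ a : Fin 15, (!(atomPat3 a 3)) = decide (a ∈ ({2, 3, 4, 5, 6, 7, 11, 12, 13, 14} : Finset (Fin 15))) := by decide
  have aXY : ∀ a : Fin 15, ((!(atomPat3 a 0)) && ((!(atomPat3 a 3)) && (!(atomPat3 a 4)))) = decide (a ∈ ({5, 7, 11, 13, 14} : Finset (Fin 15))) := by decide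
  simp only [aXY] at h; simp only [aA, aB] at h; simp only [aAB, decide_eq_true_eq] at h
  have hb : HubCert3.Part1.H14 (innerMass3 p ends μ) = (∑ a, if a ∈ ({2, 3, 4, 5, 6, 7, 11, 12, 13, 14} : Finset (Fin 15)) then innerMass3 p ends μ a else 0) * (∑ a, if a ∈ ({5, 7, 11, 13, 14} : Finset (Fin 15)) then innerMass3 p ends μ a else 0) - (∑ a, if a ∈ ({3, 4, 5, 7, 11, 13, 14} : Finset (Fin 15)) then innerMass3 p ends μ a else 0) * (∑ a, if a ∈ ({5, 6, 7, 11, 12, 13, 14} : Finset (Fin 15)) then innerMass3 p ends μ a else 0) := by simp only [HubCert3.Part1.H14, Fin.sum_univ_succ, Fin.sum_univ_zero]; simp; ring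
  rw [hb]; linarith

/-- `VDBK(s=b,A=,B=1,X=o1,Y=2)` — block 57 (first in part 3) — is nonnegative at the inner masses: `vdBK` on the inner graph (source `b`; `P(s~A, s≁X)·P(s~B, s≁Y) ≤ P(s~A∪B, s≁X∩Y)·P(s≁X∪Y)`), the mark-image Finsets resolved by the injectivity of `μ`. -/
theorem part3_H57_nonneg (p : E → R) (hp : IsProbVec p) (hinj : Function.Injective μ) : 0 ≤ HubCert3.Part3.H57 (innerMass3 p ends μ) := by
  have h := vdBK (NewVertex.pinZ p ends (μ .a₃)) (NewVertex.isProbVec_pinZ p ends (μ .a₃) hp) ends (μ .b) (∅ : Finset V) ({μ .a₁} : Finset V) ({μ .o, μ .a₁} : Finset V) ({μ .a₂} : Finset V)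
  have hXY : ({μ .o, μ .a₁} : Finset V) ∩ ({μ .a₂} : Finset V) = (∅ : Finset V) := by
    rw [show ({μ .o, μ .a₁} : Finset V) = Finset.image μ ({Mark.o, Mark.a₁} : Finset Mark) by simp, show ({μ .a₂} : Finset V) = Finset.image μ ({Mark.a₂} : Finset Mark) by simp, ← Finset.image_inter _ _ hinj, show ({Mark.o, Mark.a₁} : Finset Mark) ∩ ({Mark.a₂} : Finset Mark) = ∅ by decide]
    simp
  have hXuY : ({μ .o, μ .a₁} : Finset V) ∪ ({μ .a₂} : Finset V) = ({μ .o, μ .a₁, μ .a₂} : Finset V) := by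
    rw [show ({μ .o, μ .a₁} : Finset V) = Finset.image μ ({Mark.o, Mark.a₁} : Finset Mark) by simp, show ({μ .a₂} : Finset V) = Finset.image μ ({Mark.a₂} : Finset Mark) by simp, ← Finset.image_union, show ({Mark.o, Mark.a₁} : Finset Mark) ∪ ({Mark.a₂} : Finset Mark) = {Mark.o, Mark.a₁, Mark.a₂} by decide]
    simp
  rw [hXY, hXuY] at h
  simp only [prob_inner_eq_pinZ_vdbk] at h
  have e_b1 : ∀ ω : Config E, Conn ends (innerConfig3 ends μ ω) (μ .b) (μ .a₁) ↔ innerPat3 ends μ ω 4 = true := fun ω => ⟨fun h => (innerPat3_eq_true_iff ω 4).mpr (conn_symm h), fun h => conn_symm ((innerPat3_eq_true_iff ω 4).mp h)⟩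
  have e_b2 : ∀ ω : Config E, Conn ends (innerConfig3 ends μ ω) (μ .b) (μ .a₂) ↔ innerPat3 ends μ ω 5 = true := fun ω => ⟨fun h => (innerPat3_eq_true_iff ω 5).mpr (conn_symm h), fun h => conn_symm ((innerPat3_eq_true_iff ω 5).mp h)⟩
  have e_bo : ∀ ω : Config E, Conn ends (innerConfig3 ends μ ω) (μ .b) (μ .o) ↔ innerPat3 ends μ ω 2 = true := fun ω => ⟨fun h => (innerPat3_eq_true_iff ω 2).mpr (conn_symm h), fun h => conn_symm ((innerPat3_eq_true_iff ω 2).mp h)⟩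
  have eA : {ω : Config E | innerConfig3 ends μ ω ∈ connAll ends (μ .b) (∅ : Finset V) ∩ avoidAll ends (μ .b) ({μ .o, μ .a₁} : Finset V)} = {ω | ((!(innerPat3 ends μ ω 2)) && (!(innerPat3 ends μ ω 4))) = true} := by ext ω; simp only [Set.mem_setOf_eq, Set.mem_inter_iff, connAll, avoidAll, Finset.notMem_empty, false_imp_iff, implies_true, true_and, Finset.mem_insert, Finset.mem_singleton, forall_eq_or_imp, forall_eq, Bool.and_eq_true, Bool.not_eq_true', Bool.not_eq_true, e_b1, e_bo]
  have eB : {ω : Config E | innerConfig3 ends μ ω ∈ connAll ends (μ .b) ({μ .a₁} : Finset V) ∩ avoidAll ends (μ .b) ({μ .a₂} : Finset V)} = {ω | (innerPat3 ends μ ω 4 && (!(innerPat3 ends μ ω 5))) = true} := by ext ω; simp only [Set.mem_setOf_eq, Set.mem_inter_iff, connAll, avoidAll, Finset.mem_singleton, forall_eq, Finset.mem_singleton, forall_eq, Bool.and_eq_true, Bool.not_eq_true', Bool.not_eq_true, e_b1, e_b2]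
  have eAB : {ω : Config E | innerConfig3 ends μ ω ∈ connAll ends (μ .b) ((∅ : Finset V) ∪ ({μ .a₁} : Finset V)) ∩ avoidAll ends (μ .b) (∅ : Finset V)} = {ω | innerPat3 ends μ ω 4 = true} := by ext ω; simp only [Set.mem_setOf_eq, Set.mem_inter_iff, connAll, avoidAll, Finset.empty_union, Finset.mem_singleton, forall_eq, Finset.notMem_empty, false_imp_iff, implies_true, and_true, e_b1]
  have eXY : {ω : Config E | innerConfig3 ends μ ω ∈ avoidAll ends (μ .b) ({μ .o, μ .a₁, μ .a₂} : Finset V)} = {ω | ((!(innerPat3 ends μ ω 2)) && ((!(innerPat3 ends μ ω 4)) && (!(innerPat3 ends μ ω 5)))) = true} := by ext ω; simp only [Set.mem_setOf_eq, avoidAll, Finset.mem_insert, Finset.mem_singleton, forall_eq_or_imp, forall_eq, Bool.and_eq_true, Bool.not_eq_true', Bool.not_eq_true, e_b1, e_b2, e_bo]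
  rw [eA, eB, eAB, eXY, prob_patEvent3 p (fun π => ((!(π 2)) && (!(π 4)))), prob_patEvent3 p (fun π => (π 4 && (!(π 5)))), prob_patEvent3 p (fun π => π 4), prob_patEvent3 p (fun π => ((!(π 2)) && ((!(π 4)) && (!(π 5)))))] at h
  have aA : ∀ a : Fin 15, ((!(atomPat3 a 2)) && (!(atomPat3 a 4))) = decide (a ∈ ({1, 3, 4, 7, 10, 13, 14} : Finset (Fin 15))) := by decide
  have aB : ∀ a : Fin 15, (atomPat3 a 4 && (!(atomPat3 a 5))) = decide (a ∈ ({2, 6, 12} : Finset (Fin 15))) := by decide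
  have aAB : ∀ a : Fin 15, atomPat3 a 4 = decide (a ∈ ({0, 2, 6, 9, 12} : Finset (Fin 15))) := by decide
  have aXY : ∀ a : Fin 15, ((!(atomPat3 a 2)) && ((!(atomPat3 a 4)) && (!(atomPat3 a 5)))) = decide (a ∈ ({1, 4, 7, 10, 14} : Finset (Fin 15))) := by decide
  simp only [aXY] at h; simp only [aA, aB] at h; simp only [aAB, decide_eq_true_eq] at h
  have hb : HubCert3.Part3.H57 (innerMass3 p ends μ) = (∑ a, if a ∈ ({0, 2, 6, 9, 12} : Finset (Fin 15)) then innerMass3 p ends μ a else 0) * (∑ a, if a ∈ ({1, 4, 7, 10, 14} : Finset (Fin 15)) then innerMass3 p ends μ a else 0) - (∑ a, if a ∈ ({1, 3, 4, 7, 10, 13, 14} : Finset (Fin 15)) then innerMass3 p ends μ a else 0) * (∑ a, if a ∈ ({2, 6, 12} : Finset (Fin 15)) then innerMass3 p ends μ a else 0) := by simp only [HubCert3.Part3.H57, Fin.sum_univ_succ, Fin.sum_univ_zero]; simp; ring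
  rw [hb]; linarith

/-- Block 5 of part 2 is the block 5 of part 1 (textually the same polynomial). -/
theorem part2_H5_nonneg (p : E → R) (hp : IsProbVec p) (hinj : Function.Injective μ) : 0 ≤ HubCert3.Part2.H5 (innerMass3 p ends μ) :=
  part1_H5_nonneg p hp hinj

/-- Block 5 of part 3 is the block 5 of part 1 (textually the same polynomial). -/
theorem part3_H5_nonneg (p : E → R) (hp : IsProbVec p) (hinj : Function.Injective μ) : 0 ≤ HubCert3.Part3.H5 (innerMass3 p ends μ) :=
  part1_H5_nonneg p hp hinj

/-- Block 5 of part 4 is the block 5 of part 1 (textually the same polynomial). -/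
theorem part4_H5_nonneg (p : E → R) (hp : IsProbVec p) (hinj : Function.Injective μ) : 0 ≤ HubCert3.Part4.H5 (innerMass3 p ends μ) :=
  part1_H5_nonneg p hp hinj

/-- Block 5 of part 5 is the block 5 of part 1 (textually the same polynomial). -/
theorem part5_H5_nonneg (p : E → R) (hp : IsProbVec p) (hinj : Function.Injective μ) : 0 ≤ HubCert3.Part5.H5 (innerMass3 p ends μ) :=
  part1_H5_nonneg p hp hinj

/-- Block 5 of part 6 is the block 5 of part 1 (textually the same polynomial). -/
theorem part6_H5_nonneg (p : E → R) (hp : IsProbVec p) (hinj : Function.Injective μ) : 0 ≤ HubCert3.Part6.H5 (innerMass3 p ends μ) :=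
  part1_H5_nonneg p hp hinj

/-- Block 14 of part 2 is the block 14 of part 1 (textually the same polynomial). -/
theorem part2_H14_nonneg (p : E → R) (hp : IsProbVec p) (hinj : Function.Injective μ) : 0 ≤ HubCert3.Part2.H14 (innerMass3 p ends μ) :=
  part1_H14_nonneg p hp hinj

/-- Block 14 of part 3 is the block 14 of part 1 (textually the same polynomial). -/
theorem part3_H14_nonneg (p : E → R) (hp : IsProbVec p) (hinj : Function.Injective μ) : 0 ≤ HubCert3.Part3.H14 (innerMass3 p ends μ) :=
  part1_H14_nonneg p hp hinj

/-- Block 14 of part 4 is the block 14 of part 1 (textually the same polynomial). -/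
theorem part4_H14_nonneg (p : E → R) (hp : IsProbVec p) (hinj : Function.Injective μ) : 0 ≤ HubCert3.Part4.H14 (innerMass3 p ends μ) :=
  part1_H14_nonneg p hp hinj

/-- Block 14 of part 5 is the block 14 of part 1 (textually the same polynomial). -/
theorem part5_H14_nonneg (p : E → R) (hp : IsProbVec p) (hinj : Function.Injective μ) : 0 ≤ HubCert3.Part5.H14 (innerMass3 p ends μ) :=
  part1_H14_nonneg p hp hinj

/-- Block 14 of part 6 is the block 14 of part 1 (textually the same polynomial). -/
theorem part6_H14_nonneg (p : E → R) (hp : IsProbVec p) (hinj : Function.Injective μ) : 0 ≤ HubCert3.Part6.H14 (innerMass3 p ends μ) :=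
  part1_H14_nonneg p hp hinj

end Summit.Ventures.PercRepro2.Hub3
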